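import Literature.Combinatorics.Sahi2008.Functional

/-!
# Sahi (2008): order two of the hierarchy IS the FKG inequality

CITATION HEADER.  Sources: [Sahi2008, p. 210]; [LiebSahi2021, §1, eqs. (1.1)–(1.2)]: "`E_2(f,g) = E(fg) − E(f)E(g)`
… if `f, g` are positive monotone functions on `L`, then `E_2(f,g) ≥ 0` … the celebrated FKG inequality of
Fortuin–Kasteleyn–Ginibre [FKG]"; C. M. Fortuin, P. W. Kasteleyn, J. Ginibre, Comm. Math. Phys. **22** (1971)
89–103 [FortuinKasteleynGinibre1971].  Mathlib: `fkg` (`Mathlib/Combinatorics/SetFamily/FourFunctions.lean`, via the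
Ahlswede–Daykin four functions theorem).

What is proved (no named facts):
* `sahiE_two_nonneg_iff` — instance by instance, `0 ≤ E_2(f,g)` is literally the FKG conclusion
  `E(f)E(g) ≤ E(fg)`;
* `ex_mul_ex_le_ex_mul` — the FKG inequality for an FKG probability weight (`IsFKGMeasure`), from Mathlib's `fkg`;
* `sahiPositive_two` — hence order-`2` Sahi positivity holds on every FKG poset ("`C_2`" of Lieb–Sahi is a
  theorem), and conversely `SahiPositive μ 2` gives back FKG for nonnegative monotone pairs
  (`ex_mul_ex_le_ex_mul_of_sahiPositive_two`); `sahiPositive_iff_fkg` packages the identification.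
Nonnegativity of `f, g` is "redundant for the second inequality" [LiebSahi2021, footnote 2] (shift by constants);
we keep Sahi's formulation with nonnegative functions, which is what `SahiPositive` quantifies over.
-/

namespace Literature.Combinatorics.Sahi2008

open Finset

variable {α : Type*} [Fintype α]

/-- `0 ≤ E_2(f,g) ↔ E(f)E(g) ≤ E(fg)`: Sahi's order-two inequality is the FKG inequality, instance by
instance. [cite: LiebSahi2021, eqs. (1.1)–(1.2)] -/
theorem sahiE_two_nonneg_iff (μ f g : α → ℝ) :
    0 ≤ sahiE μ 2 ![f, g] ↔ ex μ f * ex μ g ≤ ex μ (f * g) := by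
  rw [sahiE_two, sub_nonneg]

/-- **FKG inequality** for an FKG probability weight on a finite distributive lattice: for nonnegative monotone
`f, g`, `E(f)·E(g) ≤ E(fg)` (Mathlib's `fkg`, normalised by `∑ μ = 1`).
[cite: FortuinKasteleynGinibre1971, Thm. (Prop. 1); LiebSahi2021, eq. (1.2)] -/
theorem ex_mul_ex_le_ex_mul [DistribLattice α] {μ : α → ℝ} (hμ : IsFKGMeasure μ) {f g : α → ℝ}
    (hf : ∀ x, 0 ≤ f x) (hg : ∀ x, 0 ≤ g x) (hfm : Monotone f) (hgm : Monotone g) :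
    ex μ f * ex μ g ≤ ex μ (f * g) := by
  have h := fkg f g μ (fun x => hμ.nonneg x) (fun x => hf x) (fun x => hg x) hfm hgm hμ.mul_le_mul
  rw [hμ.sum_eq_one, one_mul] at h
  exact h

/-- **Order two of Sahi's hierarchy holds on every FKG poset** (`C_2` = FKG).
[cite: LiebSahi2021, eq. (1.2); FortuinKasteleynGinibre1971, Thm. (Prop. 1)] -/
theorem sahiPositive_two [DistribLattice α] {μ : α → ℝ} (hμ : IsFKGMeasure μ) : SahiPositive μ 2 := by
  intro f hf hmono
  rw [sahiE_two_apply, sub_nonneg]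
  exact ex_mul_ex_le_ex_mul hμ (hf 0) (hf 1) (hmono 0) (hmono 1)

/-- Conversely, order-two Sahi positivity of a weight gives the FKG inequality for nonnegative monotone pairs.
[cite: LiebSahi2021, eqs. (1.1)–(1.2)] -/
theorem ex_mul_ex_le_ex_mul_of_sahiPositive_two [Preorder α] {μ : α → ℝ} (h : SahiPositive μ 2)
    {f g : α → ℝ} (hf : ∀ x, 0 ≤ f x) (hg : ∀ x, 0 ≤ g x) (hfm : Monotone f) (hgm : Monotone g) :
    ex μ f * ex μ g ≤ ex μ (f * g) := by
  rw [← sahiE_two_nonneg_iff]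
  refine h _ (fun i x => ?_) (fun i => ?_)
  · fin_cases i
    · exact hf x
    · exact hg x
  · fin_cases i
    · exact hfm
    · exact hgm

/-- **`C_2 ⟺ FKG`**, for a given weight on a finite preorder: order-two Sahi positivity is equivalent to the FKG
inequality `E(f)E(g) ≤ E(fg)` for all nonnegative monotone `f, g`. [cite: LiebSahi2021, eqs. (1.1)–(1.2)] -/
theorem sahiPositive_two_iff_fkg [Preorder α] (μ : α → ℝ) :
    SahiPositive μ 2 ↔ ∀ f g : α → ℝ, (∀ x, 0 ≤ f x) → (∀ x, 0 ≤ g x) → Monotone f → Monotone g →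
      ex μ f * ex μ g ≤ ex μ (f * g) := by
  constructor
  · intro h f g hf hg hfm hgm
    exact ex_mul_ex_le_ex_mul_of_sahiPositive_two h hf hg hfm hgm
  · intro h f hf hmono
    rw [sahiE_two_apply, sub_nonneg]
    exact h _ _ (hf 0) (hf 1) (hmono 0) (hmono 1)

/-- Orders `≤ 2` all hold on an FKG poset. [cite: LiebSahi2021, eq. (1.2)] -/
theorem sahiPositive_of_le_two [DistribLattice α] {μ : α → ℝ} (hμ : IsFKGMeasure μ) {n : ℕ} (hn : n ≤ 2) :
    SahiPositive μ n :=
  (sahiPositive_two hμ).anti hμ.nonneg hμ.sum_eq_one hn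

end Literature.Combinatorics.Sahi2008
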